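import Summits.BirchSwinnertonDyer.Rank1Residual.GaloisImage.PropagatedConditionStableRangeThree
import Summits.BirchSwinnertonDyer.Rank1Residual.GaloisImage.KolyvaginPropagatedCount
import Literature.NumberTheory.EllipticCurves.LocalTorsionInvariants
import Literature.NumberTheory.GaloisRepresentations.ContinuousCohomologyNineTerm
import HarnessLib

/-!
# The local index of the propagated canonical structure at EVERY level:
# `#𝓕_can(E[3^{k+1}])_v = #E(ℚ_v)[3^{k+1}] · #(𝓞_v/3^{k+1})²`, hence `[𝓕_can(v₃) : 𝓚(v₃)] = 3^{k+1}`
# (item stmt-BirchSwinnertonDyer-19561 `KimAtThreeKolyvagin.StubAtEmptyLevelThree`, helper; seat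
# bsd-addord-w2-c5 gen 4)

The closing theorem of record for the 19561 stub on pinned data
(`KimAtThreeStubOfLiftable.stubAtEmptyLevelThree_pinned_of_parts`, w2-c5 gen 3) displays the
Poitou–Tate PAIR COUNT at the empty level as a hypothesis; n1011's
`DeepLedger.natCard_selmerGroup_propagated_eq` derives that count from the Poitou–Tate family,
Tate's local Euler–Poincaré characteristic and ONE local datum — the index
`[𝓕_can(E[3^{k+1}])_{(3)} : 𝓚_{(3)}] = 3^{k+1}` — which so far enters only through the `Λ`-clauses of
the Kato–Kurihara PORT (Kim 2022 Prop. 3.12).  The tree has the index at LEVEL ONE (n1011-p04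
`EP.natCard_propagatedSelmerStructureOne_of_mem`).  This file proves it at EVERY level (`p = 3`, every
finite place `v`, no reduction / image hypothesis):
* `natCard_galoisCohomology_toLocal_torsion_pow_mul_eq_sq` : Tate's count of `H¹(ℚ_v, E[3^j·3])`;
* **`natCard_propagatedSelmerStructure_three_inr(_of_stable)`** :
  `#𝓕_can(E[3^k·3])_v = #E(ℚ_v)[3^{k+1}] · #(𝓞_v/3^{k+1})²`;
* **`natCard_propagatedSelmerStructure_three_of_mem`** : at `v ∣ 3`,
  `#𝓕_can(E[3^k·3])_{(3)} = 3^{k+1} · #𝓚_{(3)}(E[3^k·3])` — the local index WITHOUT a port.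

Proof: with `N₀` a `3`-power torsion-stabilisation level of `E(ℚ_v)`, `j = N₀`, `m = j + 1 + k` and
a reduction `r : L_m = E[3^m·3] → L_k` acting as `3^{j+1}`, n1011-p13's
`range_localMap_red_eq_propagatedSelmerStructure_three` ([MR04] Prop. A.2) gives
`𝓕_can,k(v) = im r_*`.  In the long exact sequence of `0 → L_j →(ι) L_m →(r) L_k → 0` over `Γ_{ℚ_v}`
(tree `IsSES.δ₀` and its exactness lemmas) the map `H⁰(L_m) → H⁰(L_k)` is ZERO (`H⁰(ℚ_v, L_m) =
E(ℚ_v)[3^{m+1}]` is killed by `3^{N₀}`), so `#im r_* · #H¹(L_j) = #H¹(L_m) · #E(ℚ_v)[3^{k+1}]`;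
Tate's counts of the two `H¹`, torsion stability and `#(𝓞_v/3^{m+1}) = #(𝓞_v/3^{j+1})·#(𝓞_v/3^{k+1})`
finish.  References: [MazurRubin2004] App. A Prop. A.2, Prop. 2.3.5; [MilneADT2006] I Thm. 2.8,
3.2, Lemma 3.3; Greenberg LNM 1716 §2; [Kim2022StructureSelmer] Prop. 3.12.
-/


set_option autoImplicit false
-- the Theorems namespace of a single-conjunct summit repeats the summit name by design (D-0017)
set_option linter.dupNamespace false

noncomputable section

open scoped Classical NumberField ContRepresentation
open Field NumberField IsDedekindDomain Function
open WeierstrassCurve Literature.NumberTheory.EllipticCurves Literature.NumberTheory.GaloisRepresentations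
  Literature.NumberTheory.GaloisRepresentations.DiscreteGaloisModule Literature.NumberTheory.GaloisCohomology
open Summit.BirchSwinnertonDyer.Rank1Residual.GaloisImage

universe u

namespace Summit.BirchSwinnertonDyer.BirchSwinnertonDyer.Theorems.KimAtThreeStubLocalIndex

/-! ### §0. Two counting lemmas -/

/-- `#A = #ker f · #im f` for a homomorphism out of a finite abelian group. [folklore] -/
theorem natCard_eq_card_ker_mul_card_range {A B : Type*} [AddCommGroup A] [AddCommGroup B]
    [Finite A] (f : A →+ B) : Nat.card A = Nat.card f.ker * Nat.card f.range := by
  rw [← Nat.card_congr (QuotientAddGroup.quotientKerEquivRange f).toEquiv, mul_comm]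
  exact AddSubgroup.card_eq_card_quotient_mul_card_addSubgroup f.ker

/-- `#(𝓞_v/3^{a+b}) = #(𝓞_v/3^a) · #(𝓞_v/3^b)` in the `v`-adic integers of `ℚ`. [folklore] -/
theorem natCard_quot_pow_add (v : HeightOneSpectrum (𝓞 ℚ)) (a b : ℕ) :
    Nat.card (v.adicCompletionIntegers ℚ ⧸
        Ideal.span {((3 ^ (a + b) : ℕ) : v.adicCompletionIntegers ℚ)}) =
      Nat.card (v.adicCompletionIntegers ℚ ⧸
          Ideal.span {((3 ^ a : ℕ) : v.adicCompletionIntegers ℚ)}) *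
        Nat.card (v.adicCompletionIntegers ℚ ⧸
          Ideal.span {((3 ^ b : ℕ) : v.adicCompletionIntegers ℚ)}) := by
  have ha : ((3 ^ a : ℕ) : v.adicCompletionIntegers ℚ) ≠ 0 :=
    LocalPoints.natCast_ne_zero v (pow_ne_zero a three_ne_zero)
  rw [show ((3 ^ (a + b) : ℕ) : v.adicCompletionIntegers ℚ) =
      ((3 ^ a : ℕ) : v.adicCompletionIntegers ℚ) * ((3 ^ b : ℕ) : v.adicCompletionIntegers ℚ) by
    push_cast; ring]
  exact natCard_quotient_span_singleton_mul' ha _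

variable (W : WeierstrassCurve ℚ) [W.IsElliptic] (v : HeightOneSpectrum (𝓞 ℚ))

/-! ### §1. Tate's count `#H¹(ℚ_v, E[3^j·3]) = (#E(ℚ_v)[3^{j+1}] · #(𝓞_v/3^{j+1}))²` -/

/-- Transport of the tree's `#H¹(K_v, E[n]) = (#E(K_v)[n] · #(𝓞_v/n))²` along an equality of moduli
`n = N` (the propagated structure lives at the modulus `3^j · 3`, the cited count at `(3^{j+1} : ℕ)`);
Tate's local Euler–Poincaré characteristic is the tree THEOREM
`EP.localEulerPoincareCharacteristic_adicCompletion`. [cite: MilneADT2006, Ch. I §2, Thm. 2.8 and §3 Lemma 3.3] -/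
theorem natCard_galoisCohomology_toLocal_torsion_eq_sq_of_eq (n : ℤ) (N : ℕ) [NeZero N]
    (hn : n = N) (hN : IsPrimePow N) :
    Nat.card (galoisCohomology ((W.torsionGaloisModule n).toLocal (Sum.inr v : Place ℚ)) 1) =
      (Nat.card (nsmulAddMonoidHom N : (W.baseChange (v.adicCompletion ℚ)).toAffine.Point →+ _).ker *
        Nat.card (v.adicCompletionIntegers ℚ ⧸
          Ideal.span {((N : ℕ) : v.adicCompletionIntegers ℚ)})) ^ 2 := by
  subst hn
  change Nat.card (galoisCohomology
    (GaloisRep.restrictField (v.adicCompletion ℚ) (W.torsionGaloisModule (N : ℤ))) 1) = _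
  exact natCard_galoisCohomology_one_torsion_adicCompletion_eq_sq W v N hN
    (EP.localEulerPoincareCharacteristic_adicCompletion ℚ v)

/-- **`#H¹(ℚ_v, E[3^j·3]) = (#E(ℚ_v)[3^{j+1}] · #(𝓞_v/3^{j+1}))²`** at every finite place `v` of `ℚ`,
unconditionally (Tate's local Euler–Poincaré characteristic, Milne I Thm. 2.8, with
`#H⁰ = #H² = #E(ℚ_v)[3^{j+1}]`, Lemma 3.3 / Cor. 2.3). [cite: MilneADT2006, Ch. I §2, Thm. 2.8 and §3 Lemma 3.3] -/
theorem natCard_galoisCohomology_toLocal_torsion_pow_mul_eq_sq (j : ℕ) :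
    Nat.card (galoisCohomology
        ((W.torsionGaloisModule (((3 : ℕ) : ℤ) ^ j * ((3 : ℕ) : ℤ))).toLocal (Sum.inr v : Place ℚ)) 1) =
      (Nat.card (nsmulAddMonoidHom (3 ^ (j + 1)) :
            (W.baseChange (v.adicCompletion ℚ)).toAffine.Point →+ _).ker *
        Nat.card (v.adicCompletionIntegers ℚ ⧸
          Ideal.span {((3 ^ (j + 1) : ℕ) : v.adicCompletionIntegers ℚ)})) ^ 2 := by
  haveI : NeZero (3 ^ (j + 1)) := ⟨pow_ne_zero _ three_ne_zero⟩
  exact natCard_galoisCohomology_toLocal_torsion_eq_sq_of_eq W v _ (3 ^ (j + 1))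
    (by push_cast; ring) (Nat.prime_three.isPrimePow.pow (Nat.succ_ne_zero j))

/-! ### §2. Torsion stability: `#E(ℚ_v)[3^N]` is constant for `N ≥ N₀`, and points are killed by `3^{N₀}` -/

omit [W.IsElliptic] in
/-- Under the stabilisation binder at `N₀`, `#E(ℚ_v)[3^{N₀+1+d}] = #E(ℚ_v)[3^{N₀+1}]` for every `d`.
[cite: MazurRubin2004, App. A, Prop. A.2 (p. 79)] -/
theorem natCard_ker_nsmul_pow_eq_of_stable {N₀ : ℕ}
    (hstab : ∀ P : (W.baseChange (v.adicCompletion ℚ)).toAffine.Point,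
      3 ^ (N₀ + 1) • P = 0 → 3 ^ N₀ • P = 0) (d : ℕ) :
    Nat.card (nsmulAddMonoidHom (3 ^ (N₀ + 1 + d)) :
        (W.baseChange (v.adicCompletion ℚ)).toAffine.Point →+ _).ker =
      Nat.card (nsmulAddMonoidHom (3 ^ (N₀ + 1)) :
        (W.baseChange (v.adicCompletion ℚ)).toAffine.Point →+ _).ker := by
  haveI : Fact (Nat.Prime 3) := ⟨Nat.prime_three⟩
  induction d with
  | zero => rfl
  | succ d ih =>
    rw [← ih, show N₀ + 1 + (d + 1) = (N₀ + 1 + d) + 1 by omega]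
    exact forall_natCard_ker_nsmul_eq_of_stable W 3 v hstab (N₀ + 1 + d) (by omega)

omit [W.IsElliptic] in
/-- Under the stabilisation binder at `N₀`, a point killed by `3^N` with `N ≥ N₀` is killed by `3^{N₀}`.
[cite: MazurRubin2004, App. A, Prop. A.2 (p. 79)] -/
theorem pow_nsmul_eq_zero_of_stable {N₀ : ℕ}
    (hstab : ∀ P : (W.baseChange (v.adicCompletion ℚ)).toAffine.Point,
      3 ^ (N₀ + 1) • P = 0 → 3 ^ N₀ • P = 0)
    (N : ℕ) (hN : N₀ ≤ N) (P : (W.baseChange (v.adicCompletion ℚ)).toAffine.Point)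
    (hP : 3 ^ N • P = 0) : 3 ^ N₀ • P = 0 := by
  haveI : Fact (Nat.Prime 3) := ⟨Nat.prime_three⟩
  induction N, hN using Nat.le_induction generalizing P with
  | base => exact hP
  | succ N hN ih => exact ih P (forall_nsmul_eq_zero_of_stable W 3 v hstab N hN P hP)

/-- **`H⁰(ℚ_v, E[3^m·3])` is killed by `3^{N₀}`** for `m + 1 ≥ N₀`: an invariant of the local torsion
module is a rational torsion point (`H⁰(F, E[n]) = E(F)[n]`, tree `invariantsTorsionEquivKerZSMul`,
Silverman VIII.§1 / Milne I Lemma 3.3), to which the stabilisation binder applies.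
[cite: MilneADT2006, I Lemma 3.3] [cite: MazurRubin2004, App. A, Prop. A.2 (p. 79)] -/
theorem pow_nsmul_eq_zero_of_mem_invariants {N₀ : ℕ}
    (hstab : ∀ P : (W.baseChange (v.adicCompletion ℚ)).toAffine.Point,
      3 ^ (N₀ + 1) • P = 0 → 3 ^ N₀ • P = 0)
    (m : ℕ) (hm : N₀ ≤ m + 1) (w : geomTorsion W (((3 : ℕ) : ℤ) ^ m * ((3 : ℕ) : ℤ)))
    (hw : w ∈ (GaloisRep.restrictField (v.adicCompletion ℚ)
      (W.torsionGaloisModule (((3 : ℕ) : ℤ) ^ m * ((3 : ℕ) : ℤ)))).invariants) :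
    3 ^ N₀ • w = 0 := by
  have hn : (((3 : ℕ) : ℤ) ^ m * ((3 : ℕ) : ℤ)) ≠ 0 :=
    mul_ne_zero (pow_ne_zero _ (by norm_num)) (by norm_num)
  -- the `CharZero` instance of `ℚ_v` is passed explicitly, so that the `ℚ`-algebra structure of `ℚ_v`
  -- stays the completion's own (n1011-p04's idiom)
  set e := @WeierstrassCurve.invariantsTorsionEquivKerZSMul ℚ _ _ W _ (v.adicCompletion ℚ) _ _ _
    (charZero_adicCompletion v) hn with he
  set x : (GaloisRep.restrictField (v.adicCompletion ℚ)
      (W.torsionGaloisModule (((3 : ℕ) : ℤ) ^ m * ((3 : ℕ) : ℤ)))).invariants := ⟨w, hw⟩ with hx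
  -- the rational point `P = e x ∈ E(ℚ_v)[3^{m+1}]`
  have hP : 3 ^ (m + 1) • ((e x : (zsmulAddGroupHom (((3 : ℕ) : ℤ) ^ m * ((3 : ℕ) : ℤ)) :
      (W.baseChange (v.adicCompletion ℚ)).toAffine.Point →+ _).ker) :
        (W.baseChange (v.adicCompletion ℚ)).toAffine.Point) = 0 := by
    have h := (e x).2
    rw [AddMonoidHom.mem_ker, zsmulAddGroupHom_apply] at h
    rw [← natCast_zsmul, show ((3 ^ (m + 1) : ℕ) : ℤ) = ((3 : ℕ) : ℤ) ^ m * ((3 : ℕ) : ℤ) by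
      push_cast; ring]
    exact h
  have hP₀ := pow_nsmul_eq_zero_of_stable W v hstab (m + 1) hm _ hP
  have hex : 3 ^ N₀ • e x = 0 := Subtype.ext (by
    rw [AddSubmonoidClass.coe_nsmul, ZeroMemClass.coe_zero]; exact hP₀)
  have hx0 : 3 ^ N₀ • x = 0 := e.injective (by rw [map_nsmul, map_zero, hex])
  have h := congrArg Subtype.val hx0
  simpa [hx] using h

/-! ### §3. The count `#𝓕_can(E[3^k·3])_v = #E(ℚ_v)[3^{k+1}] · #(𝓞_v/3^{k+1})²` -/

/-- **`#𝓕_can(E[3^k·3])_v = #E(ℚ_v)[3^{k+1}] · #(𝓞_v/3^{k+1})²` under the torsion-stabilisation binder**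
(module docstring).  Mazur–Rubin App. A Prop. A.2 gives the image description; the COUNT at a general
level is this file's reading (level one: Greenberg LNM 1716 §2 / n1011-p04).
[cite: MazurRubin2004, App. A, Prop. A.2 (p. 79) and Prop. 2.3.5] [cite: MilneADT2006, Ch. I, Thm. 2.8, Thm. 3.2 and Lemma 3.3] -/
theorem natCard_propagatedSelmerStructure_three_inr_of_stable {N₀ : ℕ}
    (hstab : ∀ P : (W.baseChange (v.adicCompletion ℚ)).toAffine.Point,
      3 ^ (N₀ + 1) • P = 0 → 3 ^ N₀ • P = 0) (k : ℕ) :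
    haveI : Fact (Nat.Prime 3) := ⟨Nat.prime_three⟩
    Nat.card (propagatedSelmerStructure W 3 k (Sum.inr v)) =
      Nat.card (nsmulAddMonoidHom (3 ^ (k + 1)) :
          (W.baseChange (v.adicCompletion ℚ)).toAffine.Point →+ _).ker *
        Nat.card (v.adicCompletionIntegers ℚ ⧸
          Ideal.span {((3 ^ (k + 1) : ℕ) : v.adicCompletionIntegers ℚ)}) ^ 2 := by
  haveI : Fact (Nat.Prime 3) := ⟨Nat.prime_three⟩
  -- the levels `j = N₀`, `m = j + 1 + k`, the reduction `r : L_m → L_k` (`x ↦ 3^{j+1} x`)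
  obtain ⟨r, hr⟩ := exists_torsionReduction_three W k (N₀ + 1 + k)
  have hrj : ∀ x : geomTorsion W (((3 : ℕ) : ℤ) ^ (N₀ + 1 + k) * ((3 : ℕ) : ℤ)),
      ((r x : geomTorsion W (((3 : ℕ) : ℤ) ^ k * ((3 : ℕ) : ℤ))) : geomPoints W) =
        (((3 : ℕ) : ℤ) ^ (N₀ + 1)) • (x : geomPoints W) := fun x => by
    rw [hr, show N₀ + 1 + k - k = N₀ + 1 by omega]
  -- (F1) `im r_* = 𝓕_can,k(v)` (Mazur–Rubin Prop. A.2, n1011-p13)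
  have hrange : (DiscreteGaloisModule.localMap r (Sum.inr v : Place ℚ)).range =
      propagatedSelmerStructure W 3 k (Sum.inr v) :=
    range_localMap_red_eq_propagatedSelmerStructure_three W v hstab k (N₀ + 1 + k) (by omega) r hr
  -- the short exact sequence `0 → L_j →(ι) L_m →(r) L_k → 0` over `Γ_{ℚ_v}`
  set ι := W.torsionInclusion (TorsionLevel.pow_mul_dvd_pow_add_mul N₀ k) with hι
  have hSES := (TorsionLevel.isSES_torsionInclusion_redPow W N₀ k r hrj).restrictField
    (Place.Completion (Sum.inr v : Place ℚ))
  haveI : ∀ i : ℕ, Finite (geomTorsion W (((3 : ℕ) : ℤ) ^ i * ((3 : ℕ) : ℤ))) := fun i =>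
    finite_geomTorsion_pow_mul W 3 i
  haveI hfinA : Finite (galoisCohomology
      ((W.torsionGaloisModule (((3 : ℕ) : ℤ) ^ N₀ * ((3 : ℕ) : ℤ))).toLocal (Sum.inr v : Place ℚ)) 1) :=
    DeepLedger.finite_galoisCohomology_toLocal_inr _ v
  haveI hfinB : Finite (galoisCohomology
      ((W.torsionGaloisModule (((3 : ℕ) : ℤ) ^ (N₀ + 1 + k) * ((3 : ℕ) : ℤ))).toLocal
        (Sum.inr v : Place ℚ)) 1) :=
    DeepLedger.finite_galoisCohomology_toLocal_inr _ v
  -- (F2) `ker r_* = im ι_*`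
  have hker_r : (DiscreteGaloisModule.localMap r (Sum.inr v : Place ℚ)).ker =
      (DiscreteGaloisModule.localMap ι (Sum.inr v : Place ℚ)).range := by
    ext y
    refine ⟨fun hy => ?_, ?_⟩
    · obtain ⟨x, hx⟩ := hSES.exists_map_one_eq_of_map_one_eq_zero y hy
      exact ⟨x, hx⟩
    · rintro ⟨x, rfl⟩; exact hSES.map_one_map_one x
  -- (F3) `ker ι_* = im δ₀`
  have hker_ι : (DiscreteGaloisModule.localMap ι (Sum.inr v : Place ℚ)).ker =
      hSES.δ₀.toAddMonoidHom.range := by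
    ext x
    refine ⟨fun hx => ?_, ?_⟩
    · obtain ⟨w, hw⟩ := hSES.exists_δ₀_eq_of_map_one_eq_zero x hx
      exact ⟨w, hw⟩
    · rintro ⟨w, rfl⟩; exact hSES.map_one_δ₀ w
  -- (F4) `δ₀` is injective: `H⁰(ℚ_v, L_m)` is killed by `3^{N₀}`, so `H⁰(r) = 0`
  have hδinj : Function.Injective hSES.δ₀ := by
    intro a b hab
    rw [← sub_eq_zero, ← map_sub] at hab
    obtain ⟨w, hw, hwv⟩ := (hSES.δ₀_eq_zero_iff _).1 hab
    have hw' : w ∈ (GaloisRep.restrictField (v.adicCompletion ℚ)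
        (W.torsionGaloisModule (((3 : ℕ) : ℤ) ^ (N₀ + 1 + k) * ((3 : ℕ) : ℤ)))).invariants :=
      (ContinuousRep.mem_invariants _ _).2 fun σ => hw σ
    have hw0 : 3 ^ N₀ • w = 0 :=
      pow_nsmul_eq_zero_of_mem_invariants W v hstab (N₀ + 1 + k) (by omega) w hw'
    have h3w : 3 ^ (N₀ + 1) •
        (w : geomTorsion W (((3 : ℕ) : ℤ) ^ (N₀ + 1 + k) * ((3 : ℕ) : ℤ))) = 0 := by
      rw [pow_succ', mul_nsmul', hw0, nsmul_zero]
    have h3w' : 3 ^ (N₀ + 1) •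
        ((w : geomTorsion W (((3 : ℕ) : ℤ) ^ (N₀ + 1 + k) * ((3 : ℕ) : ℤ))) : geomPoints W) = 0 := by
      have h := congrArg Subtype.val h3w
      simpa only [AddSubgroupClass.coe_nsmul, ZeroMemClass.coe_zero] using h
    have hrw : r w = 0 := by
      apply Subtype.ext
      rw [hrj, ZeroMemClass.coe_zero, ← Nat.cast_pow, natCast_zsmul]
      exact h3w'
    have hv0 : ((a - b : _) : geomTorsion W (((3 : ℕ) : ℤ) ^ k * ((3 : ℕ) : ℤ))) = 0 := by
      rw [← hwv]; exact hrw
    exact sub_eq_zero.1 (Subtype.ext hv0)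
  -- counts (restated in this file's own elaboration so that `ring` sees the same atoms)
  have cB₀ := natCard_eq_card_ker_mul_card_range (DiscreteGaloisModule.localMap r (Sum.inr v : Place ℚ))
  have cA₀ := natCard_eq_card_ker_mul_card_range (DiscreteGaloisModule.localMap ι (Sum.inr v : Place ℚ))
  rw [hker_r, hrange] at cB₀
  rw [hker_ι] at cA₀
  have cB : Nat.card (galoisCohomology
      ((W.torsionGaloisModule (((3 : ℕ) : ℤ) ^ (N₀ + 1 + k) * ((3 : ℕ) : ℤ))).toLocal
        (Sum.inr v : Place ℚ)) 1) =
      Nat.card (DiscreteGaloisModule.localMap ι (Sum.inr v : Place ℚ)).range *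
        Nat.card (propagatedSelmerStructure W 3 k (Sum.inr v)) := cB₀
  have cA : Nat.card (galoisCohomology
      ((W.torsionGaloisModule (((3 : ℕ) : ℤ) ^ N₀ * ((3 : ℕ) : ℤ))).toLocal (Sum.inr v : Place ℚ)) 1) =
      Nat.card hSES.δ₀.toAddMonoidHom.range *
        Nat.card (DiscreteGaloisModule.localMap ι (Sum.inr v : Place ℚ)).range := cA₀
  -- `#im δ₀ = #H⁰(ℚ_v, L_k) = #E(ℚ_v)[3^{k+1}]`
  have cδ : Nat.card hSES.δ₀.toAddMonoidHom.range =
      Nat.card (nsmulAddMonoidHom (3 ^ (k + 1)) :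
        (W.baseChange (v.adicCompletion ℚ)).toAffine.Point →+ _).ker := by
    have h3k : (((3 : ℕ) : ℤ) ^ k * ((3 : ℕ) : ℤ)) ≠ 0 :=
      mul_ne_zero (pow_ne_zero _ (by norm_num)) (by norm_num)
    have hδinj' : Function.Injective hSES.δ₀.toAddMonoidHom := hδinj
    rw [← Nat.card_congr (AddMonoidHom.ofInjective hδinj').toEquiv]
    -- `H⁰` as invariants of the restricted module, then as rational torsion points
    let einv : (ContinuousRep.toTopRep (GaloisRep.restrictField (Place.Completion (Sum.inr v : Place ℚ))
        (W.torsionGaloisModule (((3 : ℕ) : ℤ) ^ k * ((3 : ℕ) : ℤ))))).ρ.invariants ≃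
        (GaloisRep.restrictField (v.adicCompletion ℚ)
          (W.torsionGaloisModule (((3 : ℕ) : ℤ) ^ k * ((3 : ℕ) : ℤ)))).invariants :=
      { toFun := fun w => ⟨w.1, (ContinuousRep.mem_invariants _ _).2 fun σ => w.2 σ⟩
        invFun := fun w => ⟨w.1, fun σ => (ContinuousRep.mem_invariants _ _).1 w.2 σ⟩
        left_inv := fun _ => rfl
        right_inv := fun _ => rfl }
    rw [Nat.card_congr einv,
      Nat.card_congr (@WeierstrassCurve.invariantsTorsionEquivKerZSMul ℚ _ _ W _ (v.adicCompletion ℚ)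
        _ _ _ (charZero_adicCompletion v) h3k).toEquiv]
    -- `ker (3^k·3 • ·) = ker (3^{k+1} • ·)` on `E(ℚ_v)`
    congr 1
  -- Tate's counts of `H¹(L_j)` and `H¹(L_m)`
  have hA := natCard_galoisCohomology_toLocal_torsion_pow_mul_eq_sq W v N₀
  have hB := natCard_galoisCohomology_toLocal_torsion_pow_mul_eq_sq W v (N₀ + 1 + k)
  -- torsion stability and `#(𝓞_v/3^{m+1}) = #(𝓞_v/3^{j+1}) · #(𝓞_v/3^{k+1})`
  have hT : Nat.card (nsmulAddMonoidHom (3 ^ (N₀ + 1 + k + 1)) :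
        (W.baseChange (v.adicCompletion ℚ)).toAffine.Point →+ _).ker =
      Nat.card (nsmulAddMonoidHom (3 ^ (N₀ + 1)) :
        (W.baseChange (v.adicCompletion ℚ)).toAffine.Point →+ _).ker := by
    rw [show N₀ + 1 + k + 1 = N₀ + 1 + (k + 1) by omega]
    exact natCard_ker_nsmul_pow_eq_of_stable W v hstab (k + 1)
  have hq := natCard_quot_pow_add v (N₀ + 1) (k + 1)
  rw [show N₀ + 1 + (k + 1) = N₀ + 1 + k + 1 by omega] at hq
  -- positivity of the factors to cancel
  haveI := W.finite_ker_nsmul_adicCompletion v (pow_ne_zero (N₀ + 1) three_ne_zero)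
  have hTpos : 0 < Nat.card (nsmulAddMonoidHom (3 ^ (N₀ + 1)) :
        (W.baseChange (v.adicCompletion ℚ)).toAffine.Point →+ _).ker := Nat.card_pos
  have hApos : 0 < Nat.card (galoisCohomology
      ((W.torsionGaloisModule (((3 : ℕ) : ℤ) ^ N₀ * ((3 : ℕ) : ℤ))).toLocal (Sum.inr v : Place ℚ)) 1) := Nat.card_pos
  have hqpos : 0 < Nat.card (v.adicCompletionIntegers ℚ ⧸
      Ideal.span {((3 ^ (N₀ + 1) : ℕ) : v.adicCompletionIntegers ℚ)}) := by
    rcases Nat.eq_zero_or_pos (Nat.card (v.adicCompletionIntegers ℚ ⧸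
      Ideal.span {((3 ^ (N₀ + 1) : ℕ) : v.adicCompletionIntegers ℚ)})) with h | h
    · rw [h, mul_zero, zero_pow two_ne_zero] at hA; omega
    · exact h
  -- assemble: `#B · #E(ℚ_v)[3^{k+1}] = #A · #𝓕`
  have key : Nat.card (galoisCohomology
      ((W.torsionGaloisModule (((3 : ℕ) : ℤ) ^ (N₀ + 1 + k) * ((3 : ℕ) : ℤ))).toLocal
        (Sum.inr v : Place ℚ)) 1) *
        Nat.card (nsmulAddMonoidHom (3 ^ (k + 1)) :
          (W.baseChange (v.adicCompletion ℚ)).toAffine.Point →+ _).ker =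
      Nat.card (galoisCohomology
        ((W.torsionGaloisModule (((3 : ℕ) : ℤ) ^ N₀ * ((3 : ℕ) : ℤ))).toLocal (Sum.inr v : Place ℚ)) 1) *
        Nat.card (propagatedSelmerStructure W 3 k (Sum.inr v)) := by
    rw [cB, cA, cδ]; ring
  rw [hA, hB, hT, hq] at key
  -- cancel `(#E(ℚ_v)[3^{j+1}] · #(𝓞_v/3^{j+1}))²`
  apply Nat.eq_of_mul_eq_mul_left
    (Nat.pos_of_ne_zero (pow_ne_zero 2 (Nat.mul_ne_zero hTpos.ne' hqpos.ne')))
  rw [← key]; ring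

/-- **`#𝓕_can(E[3^k·3])_v = #E(ℚ_v)[3^{k+1}] · #(𝓞_v/3^{k+1})²`, no binder** (a torsion-stabilisation
level exists, n1011-p13 `exists_torsion_stable`). [cite: MazurRubin2004, App. A, Prop. A.2 (p. 79) and Prop. 2.3.5]
[cite: MilneADT2006, Ch. I, Thm. 2.8, Thm. 3.2 and Lemma 3.3] -/
theorem natCard_propagatedSelmerStructure_three_inr (k : ℕ) :
    haveI : Fact (Nat.Prime 3) := ⟨Nat.prime_three⟩
    Nat.card (propagatedSelmerStructure W 3 k (Sum.inr v)) =
      Nat.card (nsmulAddMonoidHom (3 ^ (k + 1)) :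
          (W.baseChange (v.adicCompletion ℚ)).toAffine.Point →+ _).ker *
        Nat.card (v.adicCompletionIntegers ℚ ⧸
          Ideal.span {((3 ^ (k + 1) : ℕ) : v.adicCompletionIntegers ℚ)}) ^ 2 := by
  haveI : Fact (Nat.Prime 3) := ⟨Nat.prime_three⟩
  obtain ⟨N₀, hstab⟩ := exists_torsion_stable W 3 v
  exact natCard_propagatedSelmerStructure_three_inr_of_stable W v hstab k

/-- `#(ℤ₃/3^a) = 3^a` at the place of `ℚ` above `3`. [folklore] -/
theorem natCard_quot_pow_of_mem (hv : ((3 : ℕ) : 𝓞 ℚ) ∈ v.asIdeal) (a : ℕ) :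
    Nat.card (v.adicCompletionIntegers ℚ ⧸
        Ideal.span {((3 ^ a : ℕ) : v.adicCompletionIntegers ℚ)}) = 3 ^ a := by
  haveI : Fact (Nat.Prime 3) := ⟨Nat.prime_three⟩
  induction a with
  | zero =>
    rw [pow_zero, Nat.cast_one, Ideal.span_singleton_one]
    haveI : Subsingleton (v.adicCompletionIntegers ℚ ⧸ (⊤ : Ideal (v.adicCompletionIntegers ℚ))) :=
      Ideal.Quotient.subsingleton_iff.mpr rfl
    exact Nat.card_of_subsingleton 0
  | succ a ih =>
    rw [natCard_quot_pow_add v a 1, ih, pow_one, natCard_quot_adicCompletionIntegers_of_prime_mem 3 hv,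
      pow_succ]

/-- **The local index at `v ∣ 3`, WITHOUT a port: `#𝓕_can(E[3^k·3])_{(3)} = 3^{k+1} · #𝓚_{(3)}(E[3^k·3])`**
(`#𝓚_v = #E(ℚ_v)[3^{k+1}] · #(𝓞_v/3^{k+1})`, Milne I Lemma 3.3, tree `natCard_kummerSelmerStructure_inr`;
`#(ℤ₃/3^{k+1}) = 3^{k+1}`).  This is the `Λ`-clause count `[𝓕_can(v_p) : 𝓚(v_p)] = p^{k+1}` of
n1011's `DeepLedger.natCard_propagated_inr_eq` ([K22] Prop. 3.12) as a THEOREM of local Galois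
cohomology. [cite: MazurRubin2004, Prop. 2.3.5] [cite: Kim2022StructureSelmer, Prop. 3.12 (arXiv p. 17)]
[cite: MilneADT2006, Ch. I, Thm. 2.8, Thm. 3.2 and Lemma 3.3] -/
theorem natCard_propagatedSelmerStructure_three_of_mem (hv : ((3 : ℕ) : 𝓞 ℚ) ∈ v.asIdeal) (k : ℕ) :
    haveI : Fact (Nat.Prime 3) := ⟨Nat.prime_three⟩
    Nat.card (propagatedSelmerStructure W 3 k (Sum.inr v)) =
      3 ^ (k + 1) * Nat.card (W.kummerSelmerStructure (((3 : ℕ) : ℤ) ^ k * ((3 : ℕ) : ℤ)) (Sum.inr v)) := by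
  haveI : Fact (Nat.Prime 3) := ⟨Nat.prime_three⟩
  have hK : Nat.card (W.kummerSelmerStructure (((3 : ℕ) : ℤ) ^ k * ((3 : ℕ) : ℤ)) (Sum.inr v)) =
      Nat.card (nsmulAddMonoidHom (3 ^ (k + 1)) :
          (W.baseChange (v.adicCompletion ℚ)).toAffine.Point →+ _).ker *
        Nat.card (v.adicCompletionIntegers ℚ ⧸
          Ideal.span {((3 ^ (k + 1) : ℕ) : v.adicCompletionIntegers ℚ)}) := by
    have key : ∀ n : ℤ, n = ((3 ^ (k + 1) : ℕ) : ℤ) →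
        (((3 : ℕ) : ℤ) ^ k * ((3 : ℕ) : ℤ)) = n →
        Nat.card (W.kummerSelmerStructure (((3 : ℕ) : ℤ) ^ k * ((3 : ℕ) : ℤ)) (Sum.inr v)) =
          Nat.card (nsmulAddMonoidHom (3 ^ (k + 1)) :
              (W.baseChange (v.adicCompletion ℚ)).toAffine.Point →+ _).ker *
            Nat.card (v.adicCompletionIntegers ℚ ⧸
              Ideal.span {((3 ^ (k + 1) : ℕ) : v.adicCompletionIntegers ℚ)}) := by
      intro n hn hkn
      subst hn
      rw [hkn]
      exact W.natCard_kummerSelmerStructure_inr v (pow_ne_zero (k + 1) three_ne_zero)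
    exact key _ rfl (by push_cast; ring)
  rw [natCard_propagatedSelmerStructure_three_inr W v k, hK, natCard_quot_pow_of_mem v hv (k + 1)]
  ring

end Summit.BirchSwinnertonDyer.BirchSwinnertonDyer.Theorems.KimAtThreeStubLocalIndex

end
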